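import Summits.Ventures.QEC.Theorems.BB90DistanceCertificateNoZLogicalBelowTen
import Summits.Ventures.QEC.Theorems.BB90DistanceCertificateEightLogicalQubits90
import HarnessLib

/-!
# Route BB90DistanceCertificate, item Target (stmt-Ventures-19780): `QC(x⁹+y+y², 1+x²+x⁷)` on `ℤ₁₅ × ℤ₃` has
# parameters `[[90, 8, 10]]` (Bravyi et al. 2024 Table 1 row 2) — `Summit.Ventures.QEC.BB.BB90_8_10_claim`, KERNEL

The route's glue `closes` on the three closed items: `noZLogicalBelowTen_proof` (qec-type-10 on qec-search-7's KERNEL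
`bz` verdicts), `weightTenZLogical_proof` (qec-type-10, the certificate's weight-10 witness), `EightLogicalQubits90_proof`
(qec-type-02, rank certificates). Tier KERNEL throughout (axioms `propext`, `Classical.choice`, `Quot.sound`).
-/

namespace Summit.Ventures.QEC.Census.BB90

open Literature.InformationTheory.QuantumCodes Summit.Ventures.QEC.BB
  Summit.Ventures.QEC.Theses.BB90DistanceCertificate

/-- **Item Target, PROVED — `[[90, 8, 10]]` CERTIFIED**: `HasParams BB.bb90 90 8 10`. -/
theorem target90_proof : Summit.Ventures.QEC.Theses.BB90DistanceCertificate.Target :=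
  closes noZLogicalBelowTen_proof weightTenZLogical_proof Summit.Ventures.QEC.Theorems.EightLogicalQubits90_proof

/-- **The registered CLAIM leaf discharged**: `Summit.Ventures.QEC.BB.BB90_8_10_claim`. -/
theorem BB90_8_10_claim_holds : Summit.Ventures.QEC.BB.BB90_8_10_claim := target90_proof

/-- `d_Z(BB.bb90) = 10`. -/
theorem bb90_dZ : BB.bb90.css.dZ = 10 := (dX_eq_of_hasParams BB90_8_10_claim_holds).2

/-- `d_X(BB.bb90) = 10`. -/
theorem bb90_dX : BB.bb90.css.dX = 10 := (dX_eq_of_hasParams BB90_8_10_claim_holds).1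

/-- `d(BB.bb90) = 10`. -/
theorem bb90_d : BB.bb90.d = 10 := BB90_8_10_claim_holds.2.2

end Summit.Ventures.QEC.Census.BB90
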